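import Summits.Ventures.PercRepro.SingleMergeMeets

/-!
# Block counts along single merges: the rank-Lipschitz bounds

`numBlocks σ` (typer-2, SMC.lean) is the number of blocks of a partition of the marked indices.
A single merge lowers it by at most one (`numBlocks_le_mergeBlocks_add_one`, via the injection
`Quotient σ → Quotient (mergeBlocks σ i j) ⊕ Unit` that sends the block of `j` to the extra point),
and coarsening never raises it (`numBlocks_antitone`). Hence along any monotone chain of a
single-merge map the block count changes by at most one per coordinate
(`numBlocks_le_numBlocks_add_card_sdiff`), and for three-type single-merge maps on `S`:

* `five_le_numBlocks_add_card` — a nonempty configuration with `|ω|` open edges has at least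
  `5 − |ω|` blocks (singletons have cell `⊥`);
* `numBlocks_le_card_compl` — a configuration other than `⊤` has at most `|ωᶜ|` blocks
  (co-singletons have cell `⊤`).

These are exactly the «(L7) rank-Lipschitz» clauses of the SAT encodings of Lemma B
(`mining/p4/g5/addlem.py`: `|z| ≤ 3 ⇒` not `⊤`, `|z| ≤ 2 ⇒` at least three blocks (not `x`, not `o`),
`|zᶜ| ≤ 3 ⇒` not `⊥`, `|zᶜ| ≤ 2 ⇒` at most two blocks (not `r`, not `⊥`)), read off the block counts
`⊥ ↦ 4`, `r ↦ 3`, `x, o ↦ 2`, `⊤ ↦ 1`; together with `cell_singleConfig_eq_bot`,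
`cell_compl_singleConfig_eq_top` (L1, L2), `four_le_card_openEdges_of_cross4` /
`card_openEdges_add_four_le_of_cross4` (L3, L7 for `x`-points), `card_inter_add_two_le` (L4 = (P)) and
`two_le_card_inter_of_same_cell` below (L6) every lemma clause family is a kernel theorem.
-/

namespace PercRepro

open Finset

section Blocks

variable {k : ℕ}

/-- **A single merge lowers the block count by at most one.** -/
theorem numBlocks_le_mergeBlocks_add_one (σ : Setoid (Fin k)) (i j : Fin k) :
    numBlocks σ ≤ numBlocks (mergeBlocks σ i j) + 1 := by
  classical
  unfold numBlocks
  set τ := mergeBlocks σ i j with hτ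
  -- send the block of `j` to the extra point, every other block to its image
  let g : Quotient σ → Quotient τ ⊕ Unit := fun q =>
    Quotient.liftOn q (fun x => if σ x j then Sum.inr () else Sum.inl (Quotient.mk τ x)) (by
      intro x y hxy
      by_cases hx : σ x j
      · have hy : σ y j := σ.trans (σ.symm hxy) hx
        simp [hx, hy]
      · have hy : ¬ σ y j := fun hy => hx (σ.trans hxy hy)
        simp only [hx, hy, if_false]
        exact congrArg Sum.inl (Quotient.sound (le_mergeBlocks σ i j hxy)))
  have hinj : Function.Injective g := by
    intro q₁ q₂ h
    induction q₁ using Quotient.inductionOn with | h x => ?_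
    induction q₂ using Quotient.inductionOn with | h y => ?_
    simp only [g, Quotient.liftOn_mk] at h
    by_cases hx : σ x j <;> by_cases hy : σ y j
    · exact Quotient.sound (σ.trans hx (σ.symm hy))
    · simp [hx, hy] at h
    · simp [hx, hy] at h
    · simp only [hx, hy, if_false, Sum.inl.injEq] at h
      have hxy : τ x y := Quotient.exact h
      rcases hxy with hxy | ⟨-, hjy⟩ | ⟨hxj, -⟩
      · exact Quotient.sound hxy
      · exact absurd (σ.symm hjy) hy
      · exact absurd hxj hx
  calc Fintype.card (Quotient σ) ≤ Fintype.card (Quotient τ ⊕ Unit) :=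
        Fintype.card_le_of_injective g hinj
    _ = Fintype.card (Quotient τ) + 1 := by simp

/-- **Coarsening never raises the block count.** -/
theorem numBlocks_antitone {σ τ : Setoid (Fin k)} (h : σ ≤ τ) : numBlocks τ ≤ numBlocks σ := by
  classical
  unfold numBlocks
  refine Fintype.card_le_of_surjective (Quotient.map' id fun a b hab => ?_) ?_
  · exact Setoid.le_def.1 h hab
  · intro q
    induction q using Quotient.inductionOn with | h x => exact ⟨Quotient.mk σ x, rfl⟩

/-- Along a single merge the block count drops by exactly at most one (both bounds). -/
theorem numBlocks_le_add_one_of_isSingleMerge {σ τ : Setoid (Fin k)} (h : IsSingleMerge σ τ) :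
    numBlocks σ ≤ numBlocks τ + 1 := by
  obtain ⟨i, j, -, rfl⟩ := h
  exact numBlocks_le_mergeBlocks_add_one σ i j

end Blocks

section Maps

variable {S : Type} [Fintype S] [DecidableEq S]

/-- Opening one closed coordinate adds it to the open edges. -/
theorem openEdges_update_true {ω : Config S} {e : S} (he : ω e = false) :
    openEdges (Function.update ω e true) = insert e (openEdges ω) := by
  ext x
  simp only [mem_openEdges, Finset.mem_insert, Function.update_apply]
  by_cases hx : x = e
  · subst hx; simp
  · simp [hx]

omit [Fintype S] in
/-- Along a cube edge of a single-merge map the block count drops by at most one. -/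
theorem numBlocks_le_update_add_one (c : Config S → Setoid (Fin 4)) (hsm : SingleMergeMap c)
    {ω : Config S} {e : S} (he : ω e = false) :
    numBlocks (c ω) ≤ numBlocks (c (Function.update ω e true)) + 1 := by
  rcases hsm ω e he with h | h
  · rw [h]; omega
  · exact numBlocks_le_add_one_of_isSingleMerge h

/-- **The rank-Lipschitz bound along a chain**: going up from `ω₀` to `ω` opens
`|ω| − |ω₀|` coordinates, each lowering the block count by at most one. -/
theorem numBlocks_le_numBlocks_add_card_sdiff (c : Config S → Setoid (Fin 4))
    (hsm : SingleMergeMap c) {ω₀ ω : Config S} (hle : ω₀ ≤ ω) :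
    numBlocks (c ω₀) ≤ numBlocks (c ω) + ((openEdges ω).card - (openEdges ω₀).card) := by
  classical
  suffices key : ∀ n : ℕ, ∀ ω₀ : Config S, ω₀ ≤ ω → (openEdges ω).card - (openEdges ω₀).card = n →
      numBlocks (c ω₀) ≤ numBlocks (c ω) + n from key _ ω₀ hle rfl
  intro n
  induction n with
  | zero =>
    intro ω₀ hle h0
    have hsub : openEdges ω₀ ⊆ openEdges ω := openEdges_subset_of_le hle
    have hcard : (openEdges ω).card ≤ (openEdges ω₀).card := by omega
    have heq : openEdges ω₀ = openEdges ω :=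
      Finset.eq_of_subset_of_card_le hsub hcard
    rw [config_eq_of_openEdges_eq heq]
    omega
  | succ n ih =>
    intro ω₀ hle hn
    have hsub : openEdges ω₀ ⊆ openEdges ω := openEdges_subset_of_le hle
    have hne : openEdges ω \ openEdges ω₀ ≠ ∅ := by
      intro h
      rw [Finset.sdiff_eq_empty_iff_subset] at h
      have := Finset.card_le_card h
      omega
    obtain ⟨e, he⟩ := Finset.nonempty_iff_ne_empty.2 hne
    simp only [Finset.mem_sdiff, mem_openEdges] at he
    have he0 : ω₀ e = false := by
      cases h : ω₀ e
      · rfl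
      · exact absurd h he.2
    set ω₁ := Function.update ω₀ e true with hω₁
    have hle1 : ω₁ ≤ ω := by
      intro x
      rw [hω₁, Function.update_apply]
      by_cases hx : x = e
      · subst hx; simp [he.1]
      · simp only [hx, if_false]; exact hle x
    have hcard1 : (openEdges ω₁).card = (openEdges ω₀).card + 1 := by
      rw [hω₁, openEdges_update_true he0, Finset.card_insert_of_notMem]
      rw [mem_openEdges, he0]; exact Bool.false_ne_true
    have h1 := ih ω₁ hle1 (by omega)
    have h2 := numBlocks_le_update_add_one c hsm he0
    rw [← hω₁] at h2
    omega

omit [Fintype S] [DecidableEq S] in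
/-- `c ⊤ = ⊤` for a map with a crossing pair of two distinct cells. -/
theorem cell_top_eq_top (c : Config S → Setoid (Fin 4)) (hc : Monotone c) (h3 : ThreeTypes c) :
    c ⊤ = ⊤ := by
  obtain ⟨ω, h1, h2⟩ := h3 0 1 (by decide)
  apply top_le_iff.1
  calc (⊤ : Setoid (Fin 4)) = cross4 0 ⊔ cross4 1 := (cross4_sup_eq_top (by decide)).symm
    _ = c ω ⊔ c ωᶜ := by rw [h1, h2]
    _ ≤ c ⊤ := sup_le (hc le_top) (hc le_top)

/-- **(L7, lower)**: a nonempty configuration with `|ω|` open edges has at least `5 − |ω|` blocks: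
the singleton below it has four. -/
theorem five_le_numBlocks_add_card (c : Config S → Setoid (Fin 4)) (hc : Monotone c)
    (hsm : SingleMergeMap c) (h3 : ThreeTypes c) {ω : Config S} (hω : ω ≠ ⊥) :
    5 ≤ numBlocks (c ω) + (openEdges ω).card := by
  classical
  obtain ⟨e, he⟩ : ∃ e, ω e = true := by
    by_contra h
    push Not at h
    apply hω
    funext x
    show ω x = false
    cases hx : ω x
    · rfl
    · exact absurd hx (h x)
  have hle : singleConfig e ≤ ω := (singleConfig_le_iff e ω).2 he
  have h1 := numBlocks_le_numBlocks_add_card_sdiff c hsm hle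
  rw [cell_singleConfig_eq_bot c hc hsm h3 e, numBlocks_bot] at h1
  have hcard : (openEdges (singleConfig e)).card = 1 := by
    have : openEdges (singleConfig e) = {e} := by
      ext x; simp [mem_openEdges, singleConfig]
    rw [this, Finset.card_singleton]
  have hpos : 1 ≤ (openEdges ω).card := by
    rw [← hcard]; exact Finset.card_le_card (openEdges_subset_of_le hle)
  omega

/-- **(L7, upper)**: a configuration other than `⊤` has at most `|ωᶜ|` blocks: the co-singleton
above it has one. -/
theorem numBlocks_le_card_compl (c : Config S → Setoid (Fin 4)) (hc : Monotone c)
    (hsm : SingleMergeMap c) (h3 : ThreeTypes c) {ω : Config S} (hω : ω ≠ ⊤) :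
    numBlocks (c ω) ≤ (openEdges ωᶜ).card := by
  classical
  obtain ⟨e, he⟩ : ∃ e, ω e = false := by
    by_contra h
    push Not at h
    apply hω
    funext x
    show ω x = true
    cases hx : ω x
    · exact absurd hx (h x)
    · rfl
  have hle : ω ≤ (singleConfig e)ᶜ := (le_compl_singleConfig_iff e ω).2 he
  have h1 := numBlocks_le_numBlocks_add_card_sdiff c hsm hle
  rw [cell_compl_singleConfig_eq_top c hc h3 e, numBlocks_top] at h1
  have hcard : (openEdges (singleConfig e)ᶜ).card + 1 = Fintype.card S := by
    rw [openEdges_compl, Finset.card_compl]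
    have : openEdges (singleConfig e) = {e} := by
      ext x; simp [mem_openEdges, singleConfig]
    rw [this, Finset.card_singleton]
    have := Fintype.card_pos_iff.2 ⟨e⟩
    omega
  have hcomp : (openEdges ωᶜ).card + (openEdges ω).card = Fintype.card S := by
    rw [openEdges_compl, Finset.card_compl]
    have := Finset.card_le_univ (openEdges ω)
    omega
  have hsub := Finset.card_le_card (openEdges_subset_of_le hle)
  omega

/-- **(L6)**: an `x_i`-point `α` and a configuration `β` whose antipode lies in another crossing
cell share at least two open edges — in particular two crossing points of the SAME cell do (their
difference `α ⊓ βᶜ` is a `⊥`-set two steps below `α`). -/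
theorem two_le_card_inter_of_same_cell (c : Config S → Setoid (Fin 4)) (hc : Monotone c)
    (hsm : SingleMergeMap c) {α β : Config S} {i l : Fin 3} (hil : i ≠ l)
    (hα : c α = cross4 i) (hβc : c βᶜ = cross4 l) :
    2 ≤ (openEdges α ∩ openEdges β).card := by
  classical
  -- `α \ β = α ⊓ βᶜ` has cell `⊥` (cells `x_i ⊓ x_l = ⊥`) and lies below `α` of cell `x_i`
  have hbot : c (α ⊓ βᶜ) = ⊥ := cell_inf_eq_bot_of_cross4 c hc hil hα hβc
  have h2 := card_openEdges_add_two_le c hsm (inf_le_left : α ⊓ βᶜ ≤ α) hbot hα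
  rw [openEdges_inf, openEdges_compl] at h2
  have hsplit := Finset.card_sdiff_add_card_inter (openEdges α) (openEdges β)
  have : openEdges α ∩ (openEdges β)ᶜ = openEdges α \ openEdges β := by
    rw [sdiff_eq]; rfl
  rw [this] at h2
  omega

end Maps

end PercRepro
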